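import Summits.NavierStokesRegularity.NavierStokesRegularity.Theorems.StrongHypothesesLerayHopfLThreeBoundBridge
import Literature.Analysis.FluidPDE.MildSolutionsProofs
import HarnessLib

/-!
# Bridge `L^∞_t Ḣ^{1/2}_x` bound for Leray–Hopf solutions ⇒ Clay (A)

Companion of `Theorems/StrongHypothesesLerayHopfLThreeBoundBridge.lean`
(`LerayHopfLThreeBoundImpliesNavierStokesRegularity_holds`: the `L^∞(0,T; L³)` bound for all
Leray–Hopf solutions from Clay data implies Fefferman's (A)). Here the hypothesis is weakened on
the function-space axis to the other classical critical space: an a.e.-in-time bound of the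
homogeneous Sobolev seminorm `‖u(t)‖_{Ḣ^{1/2}(ℝ³)}` of every Leray–Hopf weak solution of the
unforced system from a Clay datum. By the critical Sobolev embedding `Ḣ^{1/2}(ℝ³) ↪ L³(ℝ³)`
(Bahouri–Chemin–Danchin 2011, Thm. 1.38; PROVED in the tree:
`Literature.Analysis.FunctionSpaces.eLpNorm_three_le_eHomSobolevSeminorm_half_holds`, read on real
fields through the isometry `complexify` as in `Literature.Analysis.FluidPDE.MildSolutionsProofs`)
such a bound puts `u` in `L^∞(0,T; L³)` (`lerayHopfLThreeBound_of_homSobolevHalfBound`), and the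
`L³` bridge concludes (`navierStokesRegularity_of_lerayHopfHomSobolevHalfBound`).

The hypothesis is written out as an explicit binder (no new `def`): it is the natural kernel
rendering of "every Leray–Hopf weak solution with (Clay, a fortiori `H^{1/2}`) data belongs to
`L^∞(0,T; Ḣ^{1/2}(ℝ³))`", the shape of statement asserted by claimed regularity proofs of the
harmonic-analysis family adjudicated by cell `ns-claims` (D-0090; claim C08) — this file records
only the classical, TRUE implication "that statement ⇒ (A)" (ESS 2003 + Sobolev), nothing about
the statement itself, which is open (it implies the Millennium problem (A) by this very file).

WHAT THIS IS NOT: not a claim about NS regularity or blow-up; not a claim about any author beyond the typed locator.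

## References

* H. Bahouri, J.-Y. Chemin, R. Danchin, *Fourier Analysis and Nonlinear PDE* (2011), Thm. 1.38.
  [`BahouriCheminDanchin2011`]
* L. Escauriaza, G. Seregin, V. Šverák, Russ. Math. Surveys 58 (2003), Thms. 1.3–1.4.
  [`EscauriazaSereginSverak2003`]
-/

noncomputable section

namespace Summit.NavierStokesRegularity.StrongHypotheses

open Set MeasureTheory Filter
open scoped ENNReal NNReal ContDiff
open Literature.Analysis.FluidPDE
open Literature.Analysis.FunctionSpaces.EuclideanSpace (complexify norm_complexify)
open Literature.StrongHypotheses.NavierStokesRegularity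

/-- **`L^∞_t Ḣ^{1/2}_x` ⇒ `L^∞_t L³_x` for Leray–Hopf solutions from Clay data** (critical
Sobolev embedding `Ḣ^{1/2}(ℝ³) ↪ L³(ℝ³)`, Bahouri–Chemin–Danchin 2011 Thm. 1.38, proved in the
tree as `eLpNorm_three_le_eHomSobolevSeminorm_half_holds`): if every Leray–Hopf weak solution `u`
of the unforced system on `ℝ³ × [0,T)` from a Clay datum obeys `‖u(t)‖_{Ḣ^{1/2}} ≤ M` for a.e.
`t ∈ (0,T)` (seminorm of `complexify ∘ u t`; finite values force `u t ∈ L²`), then every such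
solution lies in `L^∞(0,T; L³(ℝ³))` — the strong hypothesis `LerayHopfLThreeBound`.
[cite: BahouriCheminDanchin2011, Thm. 1.38] -/
theorem lerayHopfLThreeBound_of_homSobolevHalfBound
    (H : ∀ (ν T : ℝ), 0 < ν → 0 < T → ∀ (u₀ : EuclideanSpace ℝ (Fin 3) → EuclideanSpace ℝ (Fin 3))
      (u : ℝ → EuclideanSpace ℝ (Fin 3) → EuclideanSpace ℝ (Fin 3)),
      ContDiff ℝ ∞ u₀ → NSWave0.IsDivFree u₀ → HasRapidSpatialDecay u₀ →
      IsLerayHopfOn T ν 0 u₀ u →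
        ∃ M : ℝ≥0, ∀ᵐ t ∂(volume.restrict (Ioo 0 T)),
          Function.eHomSobolevSeminorm (1 / 2 : ℝ) (complexify ∘ u t) ≤ M) :
    LerayHopfLThreeBound := by
  intro ν T hν hT u₀ u hs hd hdec hLH
  obtain ⟨M, hM⟩ := H ν T hν hT u₀ u hs hd hdec hLH
  obtain ⟨C, hC⟩ :=
    @Literature.Analysis.FunctionSpaces.eLpNorm_three_le_eHomSobolevSeminorm_half_holds
      (EuclideanSpace ℂ (Fin 3)) _ _ _
  -- pointwise-in-time consequence of the seminorm bound
  have hslice : ∀ t ∈ Ioo 0 T,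
      Function.eHomSobolevSeminorm (1 / 2 : ℝ) (complexify ∘ u t) ≤ M →
        MemLp (u t) 3 volume ∧ eLpNorm (u t) 3 volume ≤ C * M := by
    intro t ht hbd
    have h2 : MemLp (u t) 2 volume := hLH.memLp t ⟨ht.1.le, ht.2.le⟩
    have h2c : MemLp (complexify ∘ u t) 2 volume :=
      ContinuousLinearMap.comp_memLp' (complexify (ι := Fin 3)).toContinuousLinearMap h2
    have hnorm : eLpNorm (u t) 3 volume = eLpNorm (complexify ∘ u t) 3 volume :=
      eLpNorm_congr_norm_ae (Eventually.of_forall fun x => (norm_complexify (u t x)).symm)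
    have h3 : eLpNorm (u t) 3 volume ≤ C * M := by
      rw [hnorm]
      exact (hC _ h2c).trans (by gcongr)
    have hlt : eLpNorm (u t) 3 volume < (⊤ : ℝ≥0∞) :=
      h3.trans_lt (ENNReal.mul_lt_top ENNReal.coe_lt_top ENNReal.coe_lt_top)
    exact ⟨⟨h2.aestronglyMeasurable, hlt⟩, h3⟩
  have hae : ∀ᵐ t ∂(volume.restrict (Ioo 0 T)),
      MemLp (u t) 3 volume ∧ eLpNorm (u t) 3 volume ≤ C * M := by
    filter_upwards [hM, ae_restrict_mem measurableSet_Ioo] with t hbd ht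
    exact hslice t ht hbd
  refine ⟨hae.mono fun t ht => ht.1, ?_⟩
  -- the mixed norm `L^∞(0,T; L³)` is an essential supremum of `t ↦ ‖u t‖₃`
  rw [eLqLpNorm_def, eLpNorm_exponent_top]
  refine lt_of_le_of_lt (eLpNormEssSup_le_of_ae_bound (C := ((C : ℝ≥0∞) * M).toReal) ?_)
    ENNReal.ofReal_lt_top
  filter_upwards [hae] with t ht
  rw [Real.norm_of_nonneg ENNReal.toReal_nonneg]
  exact ENNReal.toReal_mono (ENNReal.mul_ne_top ENNReal.coe_ne_top ENNReal.coe_ne_top) ht.2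

/-- **`L^∞_t Ḣ^{1/2}_x` bound for all Leray–Hopf solutions from Clay data ⇒ Clay (A).** If every
Leray–Hopf weak solution of the unforced Navier–Stokes system on `ℝ³ × [0,T)` from a smooth,
divergence-free, rapidly decaying datum obeys an a.e.-in-time bound of its `Ḣ^{1/2}(ℝ³)`
seminorm, then Fefferman's Clay statement (A) (`NavierStokesRegularity`) holds: Sobolev
`Ḣ^{1/2} ↪ L³` (`lerayHopfLThreeBound_of_homSobolevHalfBound`) and the `L³` bridge
`LerayHopfLThreeBoundImpliesNavierStokesRegularity_holds` (Escauriaza–Seregin–Šverák 2003,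
Thm. 1.4, with Leray 1934 and the local theory). The hypothesis is OPEN; only the implication is
asserted. [cite: EscauriazaSereginSverak2003, Thm. 1.4] -/
theorem navierStokesRegularity_of_lerayHopfHomSobolevHalfBound
    (H : ∀ (ν T : ℝ), 0 < ν → 0 < T → ∀ (u₀ : EuclideanSpace ℝ (Fin 3) → EuclideanSpace ℝ (Fin 3))
      (u : ℝ → EuclideanSpace ℝ (Fin 3) → EuclideanSpace ℝ (Fin 3)),
      ContDiff ℝ ∞ u₀ → NSWave0.IsDivFree u₀ → HasRapidSpatialDecay u₀ →
      IsLerayHopfOn T ν 0 u₀ u →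
        ∃ M : ℝ≥0, ∀ᵐ t ∂(volume.restrict (Ioo 0 T)),
          Function.eHomSobolevSeminorm (1 / 2 : ℝ) (complexify ∘ u t) ≤ M) :
    _root_.NavierStokesRegularity :=
  LerayHopfLThreeBoundImpliesNavierStokesRegularity_holds
    (lerayHopfLThreeBound_of_homSobolevHalfBound H)

end Summit.NavierStokesRegularity.StrongHypotheses

end
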